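import Summits.Ventures.CertifiedManyBodySolver.Theorems.M3x2EdgeSplitSymReplayDictionary
import HarnessLib

/-!
# SymReplay S4 layer A — `polyOp` algebra, Boolean side conditions, ladder-word bridge, `Fin` sums, graded-locality transfers (T6; hub-lb-sym-eng-3)
No summit or crux statement is proved here; no certificate beyond toys is replayed; nothing here predicts superconductivity.
-/

noncomputable section

namespace Summit.Ventures.CertifiedManyBodySolver.Theorems.SymReplay

open Matrix Finset
open Literature.MathematicalPhysics.QuantumLattice
open Literature.MathematicalPhysics.QuantumLattice.HubbardWave0
open Literature.MathematicalPhysics.QuantumLattice.ThermodynamicLimit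
open Literature.Probability.LatticeModels
open Literature.MathematicalPhysics.QuantumManyBody.StateRelaxation
open Summit.Ventures.CertifiedManyBodySolver.Theorems.WardSlot
open scoped ComplexOrder BigOperators

/-! ##### (a) `polyOp` algebra -/

/-- Helper `wordOp_append` (S4 chain). -/
theorem wordOp_append (Λ' : Finset (Site 2)) (u v : Word) :
    wordOp Λ' (u ++ v) = wordOp Λ' u * wordOp Λ' v := by
  simp [wordOp, List.map_append, List.prod_append]

/-- Helper `polyOp_pscale` (S4 chain). -/
theorem polyOp_pscale (Λ' : Finset (Site 2)) (q : ℚ) (p : QPoly) :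
    polyOp Λ' (pscale q p) = ((q : ℚ) : ℂ) • polyOp Λ' p :=
  polyOp_map_mul Λ' q p

/-- Helper `polyOp_psub` (S4 chain). -/
theorem polyOp_psub (Λ' : Finset (Site 2)) (p r : QPoly) :
    polyOp Λ' (psub p r) = polyOp Λ' p - polyOp Λ' r := by
  rw [psub, polyOp_append, polyOp_pscale, Rat.cast_neg, Rat.cast_one, neg_one_smul, sub_eq_add_neg]

/-- Helper `polyOp_map_mulWord` (S4 chain). -/
theorem polyOp_map_mulWord (Λ' : Finset (Site 2)) (t : ℚ × Word) (r : QPoly) :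
    polyOp Λ' (r.map fun t' => (t.1 * t'.1, t.2 ++ t'.2)) = ((t.1 : ℚ) : ℂ) • (wordOp Λ' t.2 * polyOp Λ' r) := by
  induction r with
  | nil => simp
  | cons t' r ih =>
    rw [List.map_cons, polyOp_cons, ih, polyOp_cons, mul_add, smul_add, wordOp_append, Rat.cast_mul, mul_smul,
      mul_smul_comm]

/-- Helper `polyOp_pmul` (S4 chain). -/
theorem polyOp_pmul (Λ' : Finset (Site 2)) (p r : QPoly) :
    polyOp Λ' (pmul p r) = polyOp Λ' p * polyOp Λ' r := by
  induction p with
  | nil => simp [pmul]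
  | cons t p ih =>
    have h : pmul (t :: p) r = (r.map fun t' => (t.1 * t'.1, t.2 ++ t'.2)) ++ pmul p r := rfl
    rw [h, polyOp_append, ih, polyOp_map_mulWord, polyOp_cons, add_mul, smul_mul_assoc]

/-- Helper `letterOp_adj` (S4 chain). -/
theorem letterOp_adj (Λ' : Finset (Site 2)) (ℓ : Letter) : letterOp Λ' ℓ.adj = (letterOp Λ' ℓ)ᴴ := by
  by_cases h : ℓ.x ∈ Λ'
  · have h' : ℓ.adj.x ∈ Λ' := h
    rw [letterOp_of_mem Λ' ℓ h, letterOp_of_mem Λ' ℓ.adj h']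
    show ladderLetter (orb (PolySite.pt ℓ.x h) ℓ.s, !ℓ.dag) = _
    cases ℓ.dag <;> simp [ladderLetter, creation_conjTranspose, annihilation_conjTranspose]
  · have h' : ¬ ℓ.adj.x ∈ Λ' := h
    simp [letterOp, h, h']

/-- Helper `wordOp_adjWord` (S4 chain). -/
theorem wordOp_adjWord (Λ' : Finset (Site 2)) (w : Word) : wordOp Λ' (adjWord w) = (wordOp Λ' w)ᴴ := by
  induction w with
  | nil => simp [adjWord, wordOp]
  | cons ℓ w ih =>
    have h : adjWord (ℓ :: w) = adjWord w ++ [ℓ.adj] := by simp [adjWord]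
    rw [h, wordOp_append, ih, wordOp_cons, wordOp_cons, wordOp_nil, mul_one, letterOp_adj,
      Matrix.conjTranspose_mul]

/-- Helper `polyOp_padj` (S4 chain). -/
theorem polyOp_padj (Λ' : Finset (Site 2)) (p : QPoly) : polyOp Λ' (padj p) = (polyOp Λ' p)ᴴ := by
  induction p with
  | nil => simp [padj]
  | cons t p ih =>
    have h : padj (t :: p) = (t.1, adjWord t.2) :: padj p := rfl
    rw [h, polyOp_cons, ih, polyOp_cons, Matrix.conjTranspose_add, Matrix.conjTranspose_smul, wordOp_adjWord]
    congr 1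
    rw [← Complex.ofReal_ratCast, Complex.star_def, Complex.conj_ofReal]

/-- Helper `polyOp_comm` (S4 chain). -/
theorem polyOp_comm (Λ' : Finset (Site 2)) (p r : QPoly) :
    polyOp Λ' (comm p r) = polyOp Λ' p * polyOp Λ' r - polyOp Λ' r * polyOp Λ' p := by
  rw [comm, polyOp_psub, polyOp_pmul, polyOp_pmul]

/-- Helper `polyOp_single` (S4 chain). -/
theorem polyOp_single (Λ' : Finset (Site 2)) (q : ℚ) (w : Word) : polyOp Λ' [(q, w)] = ((q : ℚ) : ℂ) • wordOp Λ' w := by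
  rw [polyOp_cons, polyOp_nil, add_zero]

/-- Faithfulness of `nfPoly` on supported polynomials (from S1). -/
theorem polyOp_nfPoly (h1 : NfFaithful) (Λ' : Finset (Site 2)) (p : QPoly) (hp : ∀ t ∈ p, SuppIn t.2 Λ') :
    polyOp Λ' (nfPoly p) = polyOp Λ' p := by
  induction p with
  | nil => simp [nfPoly]
  | cons t p ih =>
    have h : nfPoly (t :: p) = pscale t.1 (nfWord t.2) ++ nfPoly p := rfl
    rw [h, polyOp_append, ih (fun s hs => hp s (List.mem_cons_of_mem _ hs)), polyOp_cons, polyOp_pscale,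
      ← h1 Λ' t.2 (hp t List.mem_cons_self)]

/-- Isotony for polynomials supported in the smaller window. -/
theorem polyOp_incl {Λ Λ' : Finset (Site 2)} (hΛ : Λ ⊆ Λ') (p : QPoly) (hp : ∀ t ∈ p, SuppIn t.2 Λ) :
    polyOp Λ' p = fermionEmbed (PolySite.incl hΛ) (polyOp Λ p) := by
  induction p with
  | nil => simp
  | cons t p ih =>
    rw [polyOp_cons, polyOp_cons, map_add, map_smul, ← ih (fun s hs => hp s (List.mem_cons_of_mem _ hs)),
      ← wordOp_incl hΛ t.2 (hp t List.mem_cons_self)]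

/-! ##### (b) Boolean side conditions ⇒ propositions -/

/-- Helper `SuppIn_of_suppIn` (S4 chain). -/
theorem SuppIn_of_suppIn {w : Word} {S : List (Site 2)} (h : suppIn w S = true) : SuppIn w S.toFinset :=
  (suppIn_iff w S).1 h

/-- Helper `psuppIn_iff` (S4 chain). -/
theorem psuppIn_iff (p : QPoly) (S : List (Site 2)) : psuppIn p S = true ↔ ∀ t ∈ p, suppIn t.2 S = true := by
  simp [psuppIn, List.all_eq_true]

/-- Helper `subSites_iff` (S4 chain). -/
theorem subSites_iff (S T : List (Site 2)) : subSites S T = true ↔ ∀ x ∈ S, x ∈ T := by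
  simp [subSites, List.all_eq_true, memSite_iff]

/-- Helper `SuppIn.mono` (S4 chain). -/
theorem SuppIn.mono {w : Word} {Λ Λ' : Finset (Site 2)} (h : Λ ⊆ Λ') (hw : SuppIn w Λ) : SuppIn w Λ' :=
  fun ℓ hℓ => h (hw ℓ hℓ)

/-- Helper `SuppIn_append` (S4 chain). -/
theorem SuppIn_append {u v : Word} {Λ : Finset (Site 2)} : SuppIn (u ++ v) Λ ↔ SuppIn u Λ ∧ SuppIn v Λ := by
  simp only [SuppIn, List.mem_append]
  exact ⟨fun h => ⟨fun ℓ hℓ => h ℓ (Or.inl hℓ), fun ℓ hℓ => h ℓ (Or.inr hℓ)⟩,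
    fun h ℓ hℓ => hℓ.elim (h.1 ℓ) (h.2 ℓ)⟩

/-- Helper `SuppIn_adjWord` (S4 chain). -/
theorem SuppIn_adjWord {w : Word} {Λ : Finset (Site 2)} (hw : SuppIn w Λ) : SuppIn (adjWord w) Λ := by
  intro ℓ hℓ
  simp only [adjWord, List.mem_reverse, List.mem_map] at hℓ
  obtain ⟨m, hm, rfl⟩ := hℓ
  exact hw m hm

/-- `nodupSites` from `List.Nodup` (converse of `nodup_of_nodupSites`). -/
theorem nodupSites_of_nodup : ∀ (S : List (Site 2)), S.Nodup → nodupSites S = true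
  | [], _ => rfl
  | x :: S, h => by
      have h' := List.nodup_cons.1 h
      have hx : memSite x S = false := by
        cases hm : memSite x S
        · rfl
        · exact absurd ((memSite_iff x S).1 hm) h'.1
      show (!(memSite x S) && nodupSites S) = true
      rw [hx, nodupSites_of_nodup S h'.2]
      rfl

/-- A vector of the unit box is one of the nine king moves. -/
theorem add_mem_nbhd_of_mem_box {y v : Site 2} (hv : v ∈ box 2 1) : y + v ∈ nbhd y := by
  rw [mem_box] at hv
  have hv' : v = ![v 0, v 1] := by funext j; fin_cases j <;> rfl
  obtain ⟨h0a, h0b⟩ := hv 0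
  obtain ⟨h1a, h1b⟩ := hv 1
  simp only [Nat.cast_one] at h0a h0b h1a h1b
  simp only [nbhd, List.mem_flatMap, List.mem_map, List.mem_cons, List.not_mem_nil, or_false]
  refine ⟨v 0, ?_, v 1, ?_, by rw [← hv']⟩
  · interval_cases (v 0) <;> simp
  · interval_cases (v 1) <;> simp

/-- `subSites (thick S) frame` ⇒ `thicken S 1 ⊆ frame` (as finsets). -/
theorem thicken_subset_of_thick {S fr : List (Site 2)} (h : subSites (thick S) fr = true) :
    thicken S.toFinset 1 ⊆ fr.toFinset := by
  intro z hz
  rw [thicken, Finset.mem_biUnion] at hz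
  obtain ⟨y, hy, hz⟩ := hz
  rw [Nat.floor_one, Finset.mem_image] at hz
  obtain ⟨v, hv, rfl⟩ := hz
  have hmem : y + v ∈ thick S := List.mem_flatMap.2 ⟨y, List.mem_toFinset.1 hy, add_mem_nbhd_of_mem_box hv⟩
  exact List.mem_toFinset.2 ((subSites_iff _ _).1 h _ hmem)

/-! ##### (c) Raw words as tree ladder words; charges -/

/-- Helper `ladderLetter_orbLetter` (S4 chain). -/
theorem ladderLetter_orbLetter (Λ' : Finset (Site 2)) (hz : (0 : Site 2) ∈ Λ') (ℓ : Letter) (h : ℓ.x ∈ Λ') :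
    ladderLetter (orbLetter Λ' hz ℓ) = letterOp Λ' ℓ := by
  rw [orbLetter, dif_pos h, letterOp_of_mem Λ' ℓ h]

/-- Helper `ladderWord_orbWord` (S4 chain). -/
theorem ladderWord_orbWord (Λ' : Finset (Site 2)) (hz : (0 : Site 2) ∈ Λ') (w : Word) (hw : SuppIn w Λ') :
    ladderWord (orbWord Λ' hz w) = wordOp Λ' w := by
  induction w with
  | nil => simp [orbWord, wordOp]
  | cons ℓ w ih =>
    have h : orbWord Λ' hz (ℓ :: w) = orbLetter Λ' hz ℓ :: orbWord Λ' hz w := rfl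
    rw [h, ladderWord_cons, ih (fun m hm => hw m (List.mem_cons_of_mem _ hm)), wordOp_cons,
      ladderLetter_orbLetter _ _ _ (hw ℓ List.mem_cons_self)]

/-- Helper `ladderCharge_orbWord` (S4 chain). -/
theorem ladderCharge_orbWord (Λ' : Finset (Site 2)) (hz : (0 : Site 2) ∈ Λ') (w : Word) :
    ladderCharge (orbWord Λ' hz w) = wordCharge w := by
  simp only [ladderCharge, orbWord, wordCharge, List.map_map]
  rfl

/-- Helper `ladderSpinCharge_orbWord` (S4 chain). -/
theorem ladderSpinCharge_orbWord (Λ' : Finset (Site 2)) (hz : (0 : Site 2) ∈ Λ') (w : Word) :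
    ladderSpinCharge (orbWord Λ' hz w) = wordSpinCharge w := by
  simp only [ladderSpinCharge, orbWord, wordSpinCharge, List.map_map]
  congr 1
  refine List.map_congr_left fun ℓ _ => ?_
  have hs : (ofLex (if h : ℓ.x ∈ Λ' then orb (PolySite.pt ℓ.x h) ℓ.s else orb (PolySite.pt 0 hz) ℓ.s)).2 = ℓ.s := by
    split <;> rfl
  simp only [Function.comp, letterSpinCharge, orbLetter, hs]
  split_ifs <;> rfl

/-! ##### (d) List sums as `Fin`-indexed sums; the diagonal Gram form; casts -/

/-- Helper `sum_fin_get` (S4 chain). -/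
theorem sum_fin_get {M : Type*} [AddCommMonoid M] {α : Type*} (l : List α) (f : α → M) :
    ∑ k : Fin l.length, f (l.get k) = (l.map f).sum := by
  rw [Fin.sum_univ_def, show (fun k : Fin l.length => f (l.get k)) = f ∘ l.get from rfl, ← List.map_map,
    List.map_get_finRange]

/-- Helper `gramForm_diagonal_fin` (S4 chain). -/
theorem gramForm_diagonal_fin {Λ' : Finset (Site 2)} {n : ℕ} (d : Fin n → ℂ) (O : Fin n → FermionOp Λ') :
    gramForm (Matrix.diagonal d) O = ∑ k, d k • ((O k)ᴴ * O k) := by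
  unfold gramForm
  refine Finset.sum_congr rfl fun i _ => ?_
  rw [Finset.sum_eq_single i]
  · rw [Matrix.diagonal_apply_eq, Matrix.star_eq_conjTranspose]
  · intro j _ hji
    rw [Matrix.diagonal_apply_ne _ (Ne.symm hji), zero_smul]
  · intro hi; exact absurd (Finset.mem_univ i) hi

/-- Helper `qabs_eq_abs` (S4 chain). -/
theorem qabs_eq_abs (q : ℚ) : qabs q = |q| := by
  unfold qabs
  split_ifs with h
  · exact (abs_of_neg h).symm
  · exact (abs_of_nonneg (le_of_not_gt h)).symm

/-- Helper `norm_ratCast_complex` (S4 chain). -/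
theorem norm_ratCast_complex (q : ℚ) : ‖((q : ℚ) : ℂ)‖ = ((|q| : ℚ) : ℝ) := by
  rw [← Complex.ofReal_ratCast, Complex.norm_real, Real.norm_eq_abs, Rat.cast_abs]

/-! ##### (e) Graded locality: frame-level commutators transferred to a larger frame -/

/-- **`[H_{Λ'}, ΓB] = Γ[H_F, B]`** for `B ∈ Γ𝔄_I`, `thicken I 1 ⊆ F ⊆ Λ'` (both sides are the embedded
`[H_{thicken I 1}, B]`, tree `hubbardTTPrime_localHamiltonian_commutator_fermionEmbed_eq`). -/
theorem ham_commutator_transfer {I F L : Finset (Site 2)} (hIF : I ⊆ F) (hth : thicken I 1 ⊆ F) (hFL : F ⊆ L)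
    (A : FermionOp I) :
    (hubbardTTPrimeFermionInteraction 1 0 8).localHamiltonian L *
          fermionEmbed (PolySite.incl hFL) (fermionEmbed (PolySite.incl hIF) A) -
        fermionEmbed (PolySite.incl hFL) (fermionEmbed (PolySite.incl hIF) A) *
          (hubbardTTPrimeFermionInteraction 1 0 8).localHamiltonian L =
      fermionEmbed (PolySite.incl hFL)
        ((hubbardTTPrimeFermionInteraction 1 0 8).localHamiltonian F * fermionEmbed (PolySite.incl hIF) A -
          fermionEmbed (PolySite.incl hIF) A * (hubbardTTPrimeFermionInteraction 1 0 8).localHamiltonian F) := by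
  rw [hubbardTTPrime_localHamiltonian_commutator_fermionEmbed_eq 1 0 8 hIF hth A, fermionEmbed_fermionEmbed,
    fermionEmbed_fermionEmbed, PolySite.incl_trans, PolySite.incl_trans,
    hubbardTTPrime_localHamiltonian_commutator_fermionEmbed_eq 1 0 8 (hIF.trans hFL) (hth.trans hFL) A]

/-- **`[S⁺_{Λ'}, ΓZ] = Γ[S⁺_F, Z]`** for `Z ∈ 𝔄_F`, `F ⊆ Λ'`: the on-site terms `c†_{y↑}c_{y↓}` off the image of
`F` are even and far from `ΓZ` (FermionEmbedLocality). -/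
theorem spinPlus_commutator_transfer {F L : Finset (Site 2)} (hFL : F ⊆ L) (Z : FermionOp F) :
    (spinPlus : FermionOp L) * fermionEmbed (PolySite.incl hFL) Z - fermionEmbed (PolySite.incl hFL) Z * spinPlus =
      fermionEmbed (PolySite.incl hFL) ((spinPlus : FermionOp F) * Z - Z * spinPlus) := by
  classical
  set φ := PolySite.incl hFL with hφ
  set T : Finset (PolySite L) := Finset.univ.map φ with hT
  let g : PolySite L → FermionOp L := fun a => creation (orb a 0) * annihilation (orb a 1)
  have hS : (spinPlus : FermionOp L) = ∑ a, g a := rfl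
  have himage : ∑ a ∈ T, g a = fermionEmbed φ (spinPlus : FermionOp F) := by
    rw [hT, Finset.sum_map, spinPlus, fermionEmbed_sum]
    exact Finset.sum_congr rfl fun p _ => by rw [map_mul, fermionEmbed_creation, fermionEmbed_annihilation]
  have hfar : ∑ a ∈ Tᶜ, g a ∈ carEvenSubalgebra (orbs Tᶜ) := by
    refine Subalgebra.sum_mem _ fun a ha => carEvenSubalgebra_mono (fun i hi => ?_)
      (creation_mul_annihilation_mem_carEvenSubalgebra (orb_mem_orbs.2 (Finset.mem_singleton_self a))
        (orb_mem_orbs.2 (Finset.mem_singleton_self a)))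
    rw [mem_orbs, Finset.mem_singleton] at hi
    rw [mem_orbs, hi]
    exact ha
  have hdis : Disjoint (orbs Tᶜ) (orbs ((Finset.univ : Finset (PolySite F)).map φ)) := by
    rw [Finset.disjoint_left]
    intro i hi hi'
    rw [mem_orbs] at hi hi'
    exact (Finset.mem_compl.1 hi) hi'
  have hcomm : Commute (∑ a ∈ Tᶜ, g a) (fermionEmbed φ Z) :=
    commute_of_mem_carEvenSubalgebra hfar (fermionEmbed_mem_carSubalgebra φ Z) hdis
  rw [hS, ← Finset.sum_add_sum_compl T, himage, add_mul, mul_add,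
    hcomm.eq, add_sub_add_right_eq_sub, ← fermionEmbed_mul, ← fermionEmbed_mul, ← fermionEmbed_sub]

/-- **`[S⁻_{Λ'}, ΓZ] = Γ[S⁻_F, Z]`** (adjoint of the `S⁺` transfer). -/
theorem spinMinus_commutator_transfer {F L : Finset (Site 2)} (hFL : F ⊆ L) (Z : FermionOp F) :
    (spinMinus : FermionOp L) * fermionEmbed (PolySite.incl hFL) Z - fermionEmbed (PolySite.incl hFL) Z * spinMinus =
      fermionEmbed (PolySite.incl hFL) ((spinMinus : FermionOp F) * Z - Z * spinMinus) := by
  have h := congrArg Matrix.conjTranspose (spinPlus_commutator_transfer hFL Zᴴ)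
  simp only [Matrix.conjTranspose_sub, Matrix.conjTranspose_mul, ← fermionEmbed_conjTranspose,
    Matrix.conjTranspose_conjTranspose] at h
  rw [spinMinus, spinMinus, ← neg_sub, h, ← map_neg, neg_sub]

end Summit.Ventures.CertifiedManyBodySolver.Theorems.SymReplay

end
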